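import Summits.ABC.IUTFork.LanaLogLinkLiftingMono
import Summits.ABC.IUTFork.LanaLogLinkLiftingGood
import Literature.AnabelianGeometry.AbsoluteAnabelian.MonoidKummerMapsProofs
import Literature.AnabelianGeometry.AbsoluteAnabelian.MonoidKummerMapsMonoAnalyticLiftHolds
import HarnessLib

/-!
# L-LANA objects IX septies: `UniqueLifting` with the NAMED facts DISCHARGED (proof-only sequel)

Record-only, proof-only sequel (D-0012; seat abc-iut-c312-4 gen 5, L-LANA level, plan/LLANA-SPEC N12) of
`LanaLogLinkLiftingMono.lean` (the `ℚ_p` datum `padicRef`) and `LanaLogLinkLiftingGood.lean` (the good-place data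
`RefLocalDatum.ofExtension p E e`); TAKES NO SIDE on [IUTchIII] Cor. 3.12. Those files reduced LANA §5.3 (a) "any
isomorphism of `D`-prime strips can be uniquely lifted to an isomorphism of `F`-prime strips" ([IUTchI] Cor. 5.3 (ii))
at the reference datum to layer L4's NAMED facts `PairIsoDeterminedByGalois` ([AbsTopIII] Prop. 3.2 (iv), injectivity),
`GaloisIsoLiftsToTMPairIsoOfMonoAnalytic` ([IUTchII] Rmk. 1.11.1 (i) (a)) and the schema `GaloisIsoLiftsToTMPairIso H`
(Prop. 3.2 (iv), bijectivity for pairs "of hyperbolic orbicurve type" `H`). All three are now THEOREMS of the tree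
(layer L4 / L6: `pairIsoDeterminedByGalois_holds` in `MonoidKummerMapsProofs`; `galoisIsoLiftsToTMPairIsoOfMonoAnalytic_holds`
and `galoisIsoLiftsToTMPairIso_of_compact_holds` in `MonoidKummerMapsMonoAnalyticLiftHolds`, from abc-iut-L4-d3's
`Prop121vii.unitsTransport_holds` = [AbsAnab] Prop. 1.2.1 (vi)/(vii), local class field theory + Verlagerung). THIS
file plugs them in (audit note w5-d089 INFO I1, 2026-08-26T03:50Z):

* `padicRef_liftUnique`, `good_liftUnique` — the UNIQUENESS half of LANA's unique lifting holds UNCONDITIONALLY at the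
  `ℚ_p` datum and at every good-place datum; hence `logLink_lift_unique_padicRef` / `logLink_lift_unique_good` — two
  log-links sharing their étale isomorphism share their lift, with NO hypothesis (all `LanaLogTheta.LogLink.lift_unique`
  ever used);
* `padicRef_liftExists_of_cont`, `uniqueLifting_padicRef_of_cont` — at the `ℚ_p` datum the EXISTENCE half, hence
  `UniqueLifting`, follows from the continuity clause `hcont` ALONE;
* `good_liftExists_of_char_of_cont`, `good_uniqueLifting_of_char_of_cont` — at good-place data (`Π_v = E.arith`
  profinite, hence compact: the schema is instantiated at `H := CompactSpace ·.Pi`) existence, hence `UniqueLifting`,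
  follows from the characteristicity of `Δ_v ⊆ Π_v` under topological automorphisms ([IUTchII] Prop. 1.6 "the
  [group-theoretic!] subgroup"; [AbsAnab] Lem. 1.3.8) and `hcont` alone.

HONEST SCOPE. (i) `hcont` (LANA Def. 3.7.1: isomorphisms of GM-data are homeomorphisms on `M = O^▷_v`; [AbsTopIII]
Def. 3.1 (ii) pairs carry no topology on `M`, Rmk. 3.1.1) is NOT discharged and is not obviously dischargeable: the lift
over an automorphism of `G_{ℚ_p}` that does not arise from a field automorphism is the class-field-theoretic transport
of `ℚ̄_p^×`, which preserves `|·|_p` but need not respect the higher unit filtrations uniformly — whether it is continuous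
for the valuation topology on `O^▷_{ℚ̄_p}` is left OPEN here (recorded, not judged). (ii) `hker` at good places is the
genuine anabelian input (for an abstract profinite extension `E` it can fail). (iii) Archimedean places: none
(`RefLocalDatum` is nonarchimedean). [cite: LANA2026Report, §5.3 (a) p. 29]
[cite: MochizukiAbsTopIII2015, Proposition 3.2 (iv) p.72] [cite: Mochizuki2012, II Rmk 1.11.1 (i) p.50]
NOT here: any judgement.
-/

noncomputable section

namespace Summit.ABC
namespace IUTFork

open Literature.AnabelianGeometry.AbsoluteAnabelian
open scoped NNReal

variable (p : ℕ) [Fact p.Prime]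

/-! ## 1. The `ℚ_p` datum `padicRef` -/

/-- **Uniqueness half at the `ℚ_p` datum, UNCONDITIONAL**: an automorphism of the GM-data
`F_v = (G_{ℚ_p} ↷ O^▷_{ℚ̄_p})` is determined by its `G_{ℚ_p}`-component ([AbsTopIII] Prop. 3.2 (iv) injectivity,
PROVED in the tree as `pairIsoDeterminedByGalois_holds`). [cite: MochizukiAbsTopIII2015, Proposition 3.2 (iv) p.72]
[cite: LANA2026Report, §5.3 (a) p. 29] -/
theorem padicRef_liftUnique : (padicRef p).LiftUnique :=
  padicRef_liftUnique_of_pairIsoDeterminedByGalois p pairIsoDeterminedByGalois_holds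

/-- **Existence half at the `ℚ_p` datum from the continuity clause ALONE**: every topological automorphism of
`G_{ℚ_p}` extends to an automorphism of the GM-data `(G_{ℚ_p} ↷ O^▷_{ℚ̄_p})`, granted that lifted monoid
isomorphisms are bi-continuous on `O^▷` ([IUTchII] Rmk. 1.11.1 (i) (a) PROVED in the tree as
`galoisIsoLiftsToTMPairIsoOfMonoAnalytic_holds`). [cite: Mochizuki2012, II Rmk 1.11.1 (i) p.50]
[cite: LANA2026Report, §5.3 (a) p. 29] -/
theorem padicRef_liftExists_of_cont
    (hcont : ∀ e : GaloisMonoidPair.Iso (padicPair p) (padicPair p), Continuous e.isoM ∧ Continuous e.isoM.symm) :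
    (padicRef p).LiftExists :=
  padicRef_liftExists_of_monoAnalytic p galoisIsoLiftsToTMPairIsoOfMonoAnalytic_holds hcont

/-- **`UniqueLifting` at the `ℚ_p` datum from the continuity clause ALONE**: for any family of places all carrying
the `ℚ_p` reference datum, LANA's unique lifting of the log-link holds granted only that lifted monoid
isomorphisms are bi-continuous on `O^▷_{ℚ̄_p}` — both named facts of `uniqueLifting_padicRef_of_named` are theorems.
[cite: LANA2026Report, §5.3 (a) p. 29] [cite: MochizukiAbsTopIII2015, Proposition 3.2 (iv) p.72] -/
theorem uniqueLifting_padicRef_of_cont {V : Type}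
    (hcont : ∀ e : GaloisMonoidPair.Iso (padicPair p) (padicPair p), Continuous e.isoM ∧ Continuous e.isoM.symm) :
    UniqueLifting (fun _ : V => padicRef p) :=
  uniqueLifting_padicRef_of_named p pairIsoDeterminedByGalois_holds galoisIsoLiftsToTMPairIsoOfMonoAnalytic_holds
    hcont

/-- **The log-link over the `ℚ_p` data is unique over its étale isomorphism, UNCONDITIONALLY**: two log-links
between Hodge theaters on the constant `ℚ_p` reference family that share their étale isomorphism share their lift
(all that `LogLink.lift_unique` uses is the uniqueness half, now a theorem). [cite: LANA2026Report, §5.3 (a) p. 29]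
[cite: MochizukiAbsTopIII2015, Proposition 3.2 (iv) p.72] -/
theorem logLink_lift_unique_padicRef {V : Type} [Fintype V] {bad : Finset V}
    {HT HT' : HodgeTheater (fun _ : V => padicRef p) bad} (Lg Lg' : LogLink HT HT')
    (h : Lg.etaleIso = Lg'.etaleIso) : Lg.lift = Lg'.lift :=
  LogLink.lift_unique_of_liftUnique (fun _ => padicRef_liftUnique p) Lg Lg' h

/-! ## 2. The good-place data `RefLocalDatum.ofExtension p E e` (`Π_v = E.arith` profinite) -/

section Good

variable (E : FundamentalExtension.{0}) (e : E.gal ≃ₜ* PadicGal p)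

/-- **Uniqueness half at every good-place datum, UNCONDITIONAL**: an automorphism of
`F_v = (Π_v ↷ O^▷_{ℚ̄_p})` is determined by its `Π_v`-component. [cite: MochizukiAbsTopIII2015, Proposition 3.2 (iv) p.72]
[cite: LANA2026Report, §5.3 (a) p. 29] -/
theorem good_liftUnique : (RefLocalDatum.ofExtension p E e).LiftUnique :=
  good_liftUnique_of_pairIsoDeterminedByGalois p E e pairIsoDeterminedByGalois_holds

/-- **Existence half at a good-place datum from characteristicity + continuity ALONE**: `Π_v = E.arith` is
profinite, hence compact, so [AbsTopIII] Prop. 3.2 (iv) bijectivity in the `H`-schema form holds at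
`H := (CompactSpace ·.Pi)` (`galoisIsoLiftsToTMPairIso_of_compact_holds`); what remains is that `Δ_v ⊆ Π_v` is
characteristic under topological automorphisms ([IUTchII] Prop. 1.6) and the continuity clause.
[cite: MochizukiAbsTopIII2015, Proposition 3.2 (iv) p.72] [cite: Mochizuki2012, II Prop 1.6 p.31]
[cite: LANA2026Report, §5.3 (a) p. 29, §6 (Ind1) p. 31] -/
theorem good_liftExists_of_char_of_cont
    (hker : Literature.AnabelianGeometry.EtaleTheta.IsTopCharacteristic E.arith E.geom)
    (hcont : ∀ f : GaloisMonoidPair.Iso (goodPair p E e) (goodPair p E e), Continuous f.isoM ∧ Continuous f.isoM.symm) :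
    (RefLocalDatum.ofExtension p E e).LiftExists :=
  (RefLocalDatum.ofExtension p E e).liftExists_of_galoisIsoLifts (padicRef_stabilizer_isOpen p)
    (isMLFGaloisMonoidPair_goodPair p E e) (H := fun P => CompactSpace P.Pi)
    (show CompactSpace E.arith from inferInstance)
    (galoisIsoLiftsToTMPairIso_of_compact_holds _ fun _ h => h)
    ((goodPair_isTopCharacteristic_iff p E e).mpr hker) hcont

/-- **`UniqueLifting` for a family of good-place data from characteristicity + continuity ALONE** (the named facts
`PairIsoDeterminedByGalois`, `GaloisIsoLiftsToTMPairIso H` and `hMLF`, `hH` of `good_uniqueLifting_of_named` all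
discharged). [cite: LANA2026Report, §5.3 (a) p. 29] [cite: MochizukiAbsTopIII2015, Proposition 3.2 (iv) p.72] -/
theorem good_uniqueLifting_of_char_of_cont {V : Type} (Ev : V → FundamentalExtension.{0})
    (ev : ∀ v, (Ev v).gal ≃ₜ* PadicGal p)
    (hker : ∀ v, Literature.AnabelianGeometry.EtaleTheta.IsTopCharacteristic (Ev v).arith (Ev v).geom)
    (hcont : ∀ v (f : GaloisMonoidPair.Iso (goodPair p (Ev v) (ev v)) (goodPair p (Ev v) (ev v))),
      Continuous f.isoM ∧ Continuous f.isoM.symm) :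
    UniqueLifting (fun v => RefLocalDatum.ofExtension p (Ev v) (ev v)) :=
  uniqueLifting_of_ref (fun v => good_liftExists_of_char_of_cont p (Ev v) (ev v) (hker v) (hcont v))
    (fun v => good_liftUnique p (Ev v) (ev v))

/-- **The log-link over good-place data is unique over its étale isomorphism, UNCONDITIONALLY.**
[cite: LANA2026Report, §5.3 (a) p. 29] [cite: MochizukiAbsTopIII2015, Proposition 3.2 (iv) p.72] -/
theorem logLink_lift_unique_good {V : Type} [Fintype V] {bad : Finset V} (Ev : V → FundamentalExtension.{0})
    (ev : ∀ v, (Ev v).gal ≃ₜ* PadicGal p)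
    {HT HT' : HodgeTheater (fun v => RefLocalDatum.ofExtension p (Ev v) (ev v)) bad} (Lg Lg' : LogLink HT HT')
    (h : Lg.etaleIso = Lg'.etaleIso) : Lg.lift = Lg'.lift :=
  LogLink.lift_unique_of_liftUnique (fun v => good_liftUnique p (Ev v) (ev v)) Lg Lg' h

end Good

end IUTFork

end Summit.ABC

end
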